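import Literature.NumberTheory.ModularForms.EtaQuotientModularForms
import Literature.NumberTheory.QuadraticFields.ChowlaSelbergSixty
import HarnessLib

/-!
# The `5/3` singular values of the level-6 `η`-quotients of the four-step walk

Sibling of `EtaQuotientModularForms.lean` (the forms `Z(τ) = η(τ)⁴η(3τ)⁴/(η(2τ)²η(6τ)²) ∈ M₂(Γ₀(6))`
and `t(τ) = (η(2τ)η(6τ)/(η(τ)η(3τ)))⁶`) and of `QuadraticFields/ChowlaSelbergSixty.lean`. At the
CM point of [BorweinEtAl2012, §4 Remark 7 and §5 Thm. 9]

  `τ₀ = (√(−5/3) − 1)/2 = −1/2 + i√15/6`   (`bswzPoint`; `3τ₀² + 3τ₀ + 2 = 0`, discriminant `−15`)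

the four arguments `τ₀, 2τ₀, 3τ₀, 6τ₀` are integer translates of the root points of the forms
`(3,3,2)`, `(3,0,5)`, `(1,3,6)`, `(1,0,15)` — the two classes of discriminant `−15` and the two
classes of discriminant `−60` — so that ALL the moduli `|η(δτ₀)|` needed are class products:

* `norm_eta_rootPoint_332_pow_four`, `norm_eta_rootPoint_136` — `|η((3+i√15)/6)|⁴ = (3/2)|η(τ₂)|⁴`,
  `|η((3+i√15)/2)| = |η(τ₁)|` (equivalent forms have equal Epstein zeta functions, so equal
  Kronecker-limit constants `2γ − log(D/a) − 4 log|η(τ_Q)|`);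
* `norm_dombHauptmodul_bswzPoint` — **`|t(τ₀)| = 1/64`**: `|η(2τ₀)η(6τ₀)|⁴/|η(τ₀)η(3τ₀)|⁴ =
  ((3/32)|η(τ₁)η(τ₂)|⁴)/((3/2)|η(τ₁)η(τ₂)|⁴) = 1/16` (`ChowlaSelbergSixty.norm_eta_sixty_prod`), no
  Gamma value needed — this is "the argument attains the value 1 at `τ₀`" of
  [BorweinEtAl2012, §4 Remark 7] (`x(τ)² /64 = −t(τ)`) in absolute value;
* `norm_eta_prod_bswzPoint` — **`|η(τ₀)η(2τ₀)η(3τ₀)η(6τ₀)| = √(G/1200)/π`**,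
  `G = Γ(1/15)Γ(2/15)Γ(4/15)Γ(8/15)/(Γ(7/15)Γ(11/15)Γ(13/15)Γ(14/15))`, hence with
  `|6(2τ₀+1)/π| = 2√15/π`: `(2√15/π)·|η(τ₀)η(2τ₀)η(3τ₀)η(6τ₀)| = √(G/5)/(2π²)`
  (`bswz_modular_value`) — the right-hand side of [BorweinEtAl2012, Thm. 9] `p₄(1) = √(G/5)/(2π²)`,
  through their (p4modular) `p₄(x(τ)) = (6(2τ+1)/π) η(τ)η(2τ)η(3τ)η(6τ)`;
* `norm_dombModularForm_bswzPoint_sq` — `|Z(τ₀)|² = 4G/(75π²)`.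

## References

* [BorweinEtAl2012] J. M. Borwein, A. Straub, J. Wan, W. Zudilin, *Densities of short uniform random
  walks*, Canad. J. Math. 64 (2012) 961–990 (arXiv:1103.2995), §4 Remark 7 (eqs. (y0modular),
  (p4modular)), §5 Thm. 9 ("the 5/3rd singular value").
* A. Selberg, S. Chowla, On Epstein's zeta-function, J. reine angew. Math. 227 (1967), §2.
-/

noncomputable section

open UpperHalfPlane hiding I
open Complex Filter Topology Finset
open scoped Real MatrixGroups ModularForm

open Literature.Barriers.RiemannHypothesis
open Literature.NumberTheory.QuadraticFields.KroneckerLimit (rootPoint rootPoint_re rootPoint_im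
  tendsto_epsteinZeta_sub_pole_eta)
open Literature.NumberTheory.QuadraticFields.ChowlaSelbergFifteen (tsum_indicator_epsteinTerm_eq
  map_eq_zero_iff isPosDefForm_Q₁ isPosDefForm_Q₂ isPosDefForm_Q₃)
open Literature.NumberTheory.QuadraticFields.ChowlaSelberg (chowlaSelberg_fifteen_prod
  rootPoint_mem_upperHalfPlaneSet)
open Literature.NumberTheory.QuadraticFields.ChowlaSelbergSixty (isPosDefForm_Q₅ norm_eta_sixty_prod)
open Literature.NumberTheory.EllipticCurves.ModularForms

namespace Literature.NumberTheory.ModularForms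

/-! ### The CM point `τ₀ = −1/2 + i√15/6` and the four root points -/

/-- **The CM point `τ₀ = (√(−5/3) − 1)/2 = −1/2 + i√15/6`** of [BorweinEtAl2012, §4 Remark 7].
[cite: BorweinEtAl2012, §4 Remark 7] -/
def bswzPoint : ℍ :=
  ⟨-1 / 2 + (Real.sqrt 15 / 6) * I, by
    simp only [Complex.add_im, Complex.neg_im, Complex.div_ofNat_im, Complex.one_im, neg_zero,
      zero_div, Complex.mul_im, Complex.I_re, mul_zero, Complex.I_im, mul_one, zero_add]
    norm_num⟩

/-- The underlying complex number. [folklore] -/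
theorem coe_bswzPoint : ((bswzPoint : ℍ) : ℂ) = -1 / 2 + (Real.sqrt 15 / 6) * I := rfl

/-- `√60 = 2√15`. [folklore] -/
private theorem sqrt_sixty' : Real.sqrt 60 = 2 * Real.sqrt 15 := by
  rw [show (60 : ℝ) = 2 ^ 2 * 15 by norm_num, Real.sqrt_mul (by norm_num) 15,
    Real.sqrt_sq (by norm_num)]

/-- `starkK` values of the four forms. [folklore] -/
private theorem starkK_values :
    starkK 3 3 2 = Real.sqrt 15 / 6 ∧ starkK 3 0 5 = Real.sqrt 15 / 3 ∧
      starkK 1 3 6 = Real.sqrt 15 / 2 ∧ starkK 1 0 15 = Real.sqrt 15 := by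
  unfold starkK
  refine ⟨by norm_num, ?_, by norm_num, ?_⟩
  · norm_num; rw [sqrt_sixty']; ring
  · norm_num; rw [sqrt_sixty']; ring

/-- `rootPoint 3 3 2 = τ₀ + 1`. [folklore] -/
theorem rootPoint_332 : rootPoint 3 3 2 = ((bswzPoint : ℍ) : ℂ) + 1 := by
  apply Complex.ext
  · simp [rootPoint_re, coe_bswzPoint]; norm_num
  · rw [rootPoint_im, starkK_values.1]; simp [coe_bswzPoint]

/-- `rootPoint 3 0 5 = 2τ₀ + 1 = i√(5/3)`. [folklore] -/
theorem rootPoint_305 : rootPoint 3 0 5 = 2 * ((bswzPoint : ℍ) : ℂ) + 1 := by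
  apply Complex.ext
  · simp [rootPoint_re, coe_bswzPoint]; norm_num
  · rw [rootPoint_im, starkK_values.2.1]; simp [coe_bswzPoint]; ring

/-- `rootPoint 1 3 6 = 3τ₀ + 3`. [folklore] -/
theorem rootPoint_136 : rootPoint 1 3 6 = 3 * ((bswzPoint : ℍ) : ℂ) + 3 := by
  apply Complex.ext
  · simp [rootPoint_re, coe_bswzPoint]; norm_num
  · rw [rootPoint_im, starkK_values.2.2.1]; simp [coe_bswzPoint]; ring

/-- `rootPoint 1 0 15 = 6τ₀ + 3 = i√15`. [folklore] -/
theorem rootPoint_1015 : rootPoint 1 0 15 = 6 * ((bswzPoint : ℍ) : ℂ) + 3 := by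
  apply Complex.ext
  · simp [rootPoint_re, coe_bswzPoint]; norm_num
  · rw [rootPoint_im, starkK_values.2.2.2]; simp [coe_bswzPoint]; ring

/-- `|η(z + n)| = |η(z)|` for `n ∈ ℤ`. [folklore] -/
theorem norm_eta_add_intCast (z : ℂ) (n : ℤ) : ‖η (z + n)‖ = ‖η z‖ := by
  rw [eta_add_intCast, norm_mul, show (2 * π * I * n / 24 : ℂ) = ((2 * π * n / 24 : ℝ) : ℂ) * I by
    push_cast; ring, Complex.norm_exp_ofReal_mul_I, one_mul]

/-- `|η(τ₀)| = |η(τ_{(3,3,2)})|`. [folklore] -/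
theorem norm_eta_bswzPoint : ‖η ((bswzPoint : ℍ) : ℂ)‖ = ‖η (rootPoint 3 3 2)‖ := by
  rw [rootPoint_332, ← norm_eta_add_intCast _ 1, Int.cast_one]

/-- `|η(2τ₀)| = |η(τ_{(3,0,5)})|`. [folklore] -/
theorem norm_eta_two_mul_bswzPoint : ‖η (2 * ((bswzPoint : ℍ) : ℂ))‖ = ‖η (rootPoint 3 0 5)‖ := by
  rw [rootPoint_305, ← norm_eta_add_intCast _ 1, Int.cast_one]

/-- `|η(3τ₀)| = |η(τ_{(1,3,6)})|`. [folklore] -/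
theorem norm_eta_three_mul_bswzPoint : ‖η (3 * ((bswzPoint : ℍ) : ℂ))‖ = ‖η (rootPoint 1 3 6)‖ := by
  rw [rootPoint_136, ← norm_eta_add_intCast _ 3]
  norm_num

/-- `|η(6τ₀)| = |η(τ_{(1,0,15)})|`. [folklore] -/
theorem norm_eta_six_mul_bswzPoint : ‖η (6 * ((bswzPoint : ℍ) : ℂ))‖ = ‖η (rootPoint 1 0 15)‖ := by
  rw [rootPoint_1015, ← norm_eta_add_intCast _ 3]
  norm_num

/-! ### Equivalent forms: `(3,3,2) ~ (2,1,2)` and `(1,3,6) ~ (1,1,4)` -/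

/-- `(3,3,2)` is positive definite. [folklore] -/
theorem isPosDefForm_332 : IsPosDefForm 3 3 2 := ⟨by norm_num, by norm_num⟩

/-- `(1,3,6)` is positive definite. [folklore] -/
theorem isPosDefForm_136 : IsPosDefForm 1 3 6 := ⟨by norm_num, by norm_num⟩

/-- `Z_{(3,3,2)} = Z_{(2,1,2)}`: `Q_{332}(−v, u+v) = Q₂(u,v)` (unimodular). [folklore] -/
theorem epsteinZeta_332 (s : ℂ) : epsteinZeta 3 3 2 s = epsteinZeta 2 1 2 s := by
  have hφ : Function.Injective (fun u : ℤ × ℤ => (-u.2, u.1 + u.2)) := by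
    rintro ⟨a, b⟩ ⟨c, d⟩ h
    simp only [Prod.mk.injEq] at h ⊢
    omega
  have hS : Set.range (fun u : ℤ × ℤ => (-u.2, u.1 + u.2)) = Set.univ := by
    ext ⟨x, y⟩
    simp only [Set.mem_range, Set.mem_univ, iff_true, Prod.mk.injEq]
    exact ⟨(x + y, -x), by omega, by omega⟩
  have hval : ∀ u : ℤ × ℤ, bqfEval 3 3 2 ((fun u : ℤ × ℤ => (-u.2, u.1 + u.2)) u) =
      1 * bqfEval 2 1 2 u := fun u => by
    simp only [bqfEval]; push_cast; ring
  have h := tsum_indicator_epsteinTerm_eq (by norm_num : (0 : ℝ) < 1) isPosDefForm_Q₂ hφ hS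
    (map_eq_zero_iff hφ (by simp)) hval s
  rw [Set.indicator_univ] at h
  rw [epsteinZeta, h]
  simp

/-- `Z_{(1,3,6)} = Z_{(1,1,4)}`: `Q_{136}(u − v, v) = Q₁(u,v)`. [folklore] -/
theorem epsteinZeta_136 (s : ℂ) : epsteinZeta 1 3 6 s = epsteinZeta 1 1 4 s := by
  have hφ : Function.Injective (fun u : ℤ × ℤ => (u.1 - u.2, u.2)) := by
    rintro ⟨a, b⟩ ⟨c, d⟩ h
    simp only [Prod.mk.injEq] at h ⊢
    omega
  have hS : Set.range (fun u : ℤ × ℤ => (u.1 - u.2, u.2)) = Set.univ := by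
    ext ⟨x, y⟩
    simp only [Set.mem_range, Set.mem_univ, iff_true, Prod.mk.injEq]
    exact ⟨(x + y, y), by omega, rfl⟩
  have hval : ∀ u : ℤ × ℤ, bqfEval 1 3 6 ((fun u : ℤ × ℤ => (u.1 - u.2, u.2)) u) =
      1 * bqfEval 1 1 4 u := fun u => by
    simp only [bqfEval]; push_cast; ring
  have h := tsum_indicator_epsteinTerm_eq (by norm_num : (0 : ℝ) < 1) isPosDefForm_Q₁ hφ hS
    (map_eq_zero_iff hφ (by simp)) hval s
  rw [Set.indicator_univ] at h
  rw [epsteinZeta, h]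
  simp

/-- Equal Epstein zeta functions with the same discriminant have equal Kronecker-limit invariants
`log(D/a) + 4 log|η(τ_Q)|`. [folklore] -/
theorem kroneckerInvariant_eq {a b c a' b' c' D : ℝ} (h : IsPosDefForm a b c) (h' : IsPosDefForm a' b' c')
    (hD : 4 * a * c - b ^ 2 = D) (hD' : 4 * a' * c' - b' ^ 2 = D)
    (hZ : ∀ s : ℂ, epsteinZeta a b c s = epsteinZeta a' b' c' s) :
    Real.log (D / a) + 4 * Real.log ‖η (rootPoint a b c)‖ =
      Real.log (D / a') + 4 * Real.log ‖η (rootPoint a' b' c')‖ := by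
  have k := tendsto_epsteinZeta_sub_pole_eta h
  have k' := tendsto_epsteinZeta_sub_pole_eta h'
  rw [hD] at k
  rw [hD'] at k'
  simp_rw [hZ] at k
  have heq := tendsto_nhds_unique k k'
  have hDpos : 0 < D := by rw [← hD]; linarith [h.disc_neg]
  have hc : 0 < 2 * π / Real.sqrt D := by positivity
  have hr := Complex.ofReal_injective heq
  have := mul_left_cancel₀ hc.ne' hr
  linarith

/-- **`|η((3 + i√15)/6)|⁴ = (3/2) |η((1 + i√15)/4)|⁴`** (`(3,3,2) ~ (2,1,2)`). [folklore] -/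
theorem norm_eta_rootPoint_332_pow_four :
    ‖η (rootPoint 3 3 2)‖ ^ 4 = 3 / 2 * ‖η (rootPoint 2 1 2)‖ ^ 4 := by
  have h := kroneckerInvariant_eq (D := 15) isPosDefForm_332 isPosDefForm_Q₂ (by norm_num)
    (by norm_num) epsteinZeta_332
  have hη : 0 < ‖η (rootPoint 3 3 2)‖ :=
    norm_pos_iff.mpr (ModularForm.eta_ne_zero (rootPoint_mem_upperHalfPlaneSet isPosDefForm_332))
  have hη' : 0 < ‖η (rootPoint 2 1 2)‖ :=
    norm_pos_iff.mpr (ModularForm.eta_ne_zero (rootPoint_mem_upperHalfPlaneSet isPosDefForm_Q₂))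
  refine Real.log_injOn_pos (Set.mem_Ioi.mpr (by positivity)) (Set.mem_Ioi.mpr (by positivity)) ?_
  rw [Real.log_pow, Real.log_mul (by norm_num) (by positivity), Real.log_pow]
  have h1 : Real.log ((15 : ℝ) / 3) = Real.log 15 - Real.log 3 := Real.log_div (by norm_num) (by norm_num)
  have h2 : Real.log ((15 : ℝ) / 2) = Real.log 15 - Real.log 2 := Real.log_div (by norm_num) (by norm_num)
  have h3 : Real.log ((3 : ℝ) / 2) = Real.log 3 - Real.log 2 := Real.log_div (by norm_num) (by norm_num)
  rw [h1, h2] at h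
  rw [h3]
  push_cast
  linarith

/-- **`|η((3 + i√15)/2)| = |η((1 + i√15)/2)|`** (`(1,3,6) ~ (1,1,4)`; indeed the points differ by `1`).
[folklore] -/
theorem norm_eta_rootPoint_136 : ‖η (rootPoint 1 3 6)‖ = ‖η (rootPoint 1 1 4)‖ := by
  have h := kroneckerInvariant_eq (D := 15) isPosDefForm_136 isPosDefForm_Q₁ (by norm_num)
    (by norm_num) epsteinZeta_136
  have hη : 0 < ‖η (rootPoint 1 3 6)‖ :=
    norm_pos_iff.mpr (ModularForm.eta_ne_zero (rootPoint_mem_upperHalfPlaneSet isPosDefForm_136))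
  have hη' : 0 < ‖η (rootPoint 1 1 4)‖ :=
    norm_pos_iff.mpr (ModularForm.eta_ne_zero (rootPoint_mem_upperHalfPlaneSet isPosDefForm_Q₁))
  refine Real.log_injOn_pos hη hη' ?_
  linarith

/-! ### The moduli at `τ₀` -/

/-- Abbreviation-free form of the four moduli in terms of `B₁ = |η(τ₁)|⁴`, `B₂ = |η(τ₂)|⁴`:
`|η(τ₀)|⁴ = (3/2)B₂`, `|η(3τ₀)|⁴ = B₁`, `|η(2τ₀)|⁴|η(6τ₀)|⁴ = (3/32)B₁B₂`. [folklore] -/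
theorem norm_eta_bswzPoint_pow_four :
    ‖η ((bswzPoint : ℍ) : ℂ)‖ ^ 4 = 3 / 2 * ‖η (rootPoint 2 1 2)‖ ^ 4 ∧
      ‖η (3 * ((bswzPoint : ℍ) : ℂ))‖ ^ 4 = ‖η (rootPoint 1 1 4)‖ ^ 4 ∧
        ‖η (2 * ((bswzPoint : ℍ) : ℂ))‖ ^ 4 * ‖η (6 * ((bswzPoint : ℍ) : ℂ))‖ ^ 4 =
          3 / 32 * (‖η (rootPoint 1 1 4)‖ ^ 4 * ‖η (rootPoint 2 1 2)‖ ^ 4) := by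
  refine ⟨?_, ?_, ?_⟩
  · rw [norm_eta_bswzPoint, norm_eta_rootPoint_332_pow_four]
  · rw [norm_eta_three_mul_bswzPoint, norm_eta_rootPoint_136]
  · rw [norm_eta_two_mul_bswzPoint, norm_eta_six_mul_bswzPoint, mul_comm, norm_eta_sixty_prod]

/-- Positivity of the moduli. [folklore] -/
theorem norm_eta_natMul_bswzPoint_pos (δ : ℕ) (hδ : 0 < δ) : 0 < ‖η ((δ : ℂ) * ((bswzPoint : ℍ) : ℂ))‖ :=
  norm_pos_iff.mpr (ModularForm.eta_ne_zero (im_natMul_pos hδ bswzPoint.2))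

/-- **`|t(τ₀)| = 1/64`** for `t = (η(2τ)η(6τ)/(η(τ)η(3τ)))⁶` at `τ₀ = −1/2 + i√15/6`: the ratio of the
class products of discriminants `−60` and `−15` is `(3/32)/(3/2) = 1/16 = (1/2)⁴`.
[cite: BorweinEtAl2012, §4 Remark 7] -/
theorem norm_dombHauptmodul_bswzPoint :
    ‖etaQuotient 6 dombHauptmodulExponents bswzPoint‖ = 1 / 64 := by
  obtain ⟨h1, h3, h26⟩ := norm_eta_bswzPoint_pow_four
  have p1 := norm_eta_natMul_bswzPoint_pos 1 one_pos
  have p2 := norm_eta_natMul_bswzPoint_pos 2 (by norm_num)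
  have p3 := norm_eta_natMul_bswzPoint_pos 3 (by norm_num)
  have p6 := norm_eta_natMul_bswzPoint_pos 6 (by norm_num)
  rw [Nat.cast_one, one_mul] at p1
  have hB1 : 0 < ‖η (rootPoint 1 1 4)‖ :=
    norm_pos_iff.mpr (ModularForm.eta_ne_zero (rootPoint_mem_upperHalfPlaneSet isPosDefForm_Q₁))
  have hB2 : 0 < ‖η (rootPoint 2 1 2)‖ :=
    norm_pos_iff.mpr (ModularForm.eta_ne_zero (rootPoint_mem_upperHalfPlaneSet isPosDefForm_Q₂))
  -- the ratio `r = |η(2τ₀)η(6τ₀)|/(|η(τ₀)η(3τ₀)|)` has `r⁴ = 1/16`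
  set n1 := ‖η ((bswzPoint : ℍ) : ℂ)‖ with hn1
  set n2 := ‖η (2 * ((bswzPoint : ℍ) : ℂ))‖ with hn2
  set n3 := ‖η (3 * ((bswzPoint : ℍ) : ℂ))‖ with hn3
  set n6 := ‖η (6 * ((bswzPoint : ℍ) : ℂ))‖ with hn6
  have hr4 : (n2 * n6 / (n1 * n3)) ^ 4 = (1 / 2) ^ 4 := by
    rw [div_pow, mul_pow, mul_pow, h1, h3, h26]
    field_simp
    ring
  have hr : n2 * n6 / (n1 * n3) = 1 / 2 :=
    (pow_left_inj₀ (by positivity) (by norm_num) (by norm_num : (4 : ℕ) ≠ 0)).mp hr4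
  -- unfold the η-quotient
  rw [etaQuotient_apply, show (6 : ℕ).divisors = {1, 2, 3, 6} by decide]
  rw [Finset.prod_insert (by decide), Finset.prod_insert (by decide), Finset.prod_insert (by decide),
    Finset.prod_singleton]
  simp only [dombHauptmodulExponents, Nat.cast_one, one_mul, norm_mul, norm_zpow, Nat.cast_ofNat]
  norm_num
  rw [← hn1, ← hn2, ← hn3, ← hn6]
  have hn1' : n1 ≠ 0 := p1.ne'
  have hn3' : n3 ≠ 0 := p3.ne'
  have e : (n1 ^ 6)⁻¹ * (n2 ^ 6 * ((n3 ^ 6)⁻¹ * n6 ^ 6)) = 1 / 64 := by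
    rw [show (n1 ^ 6)⁻¹ * (n2 ^ 6 * ((n3 ^ 6)⁻¹ * n6 ^ 6)) = (n2 * n6 / (n1 * n3)) ^ 6 by
      field_simp, hr]
    norm_num
  exact e

/-- **`|η(τ₀)η(2τ₀)η(3τ₀)η(6τ₀)|⁴ = (9/64)(|η(τ₁)|⁴|η(τ₂)|⁴)²`**. [folklore] -/
theorem norm_eta_prod_bswzPoint_pow_four :
    (‖η ((bswzPoint : ℍ) : ℂ)‖ * ‖η (2 * ((bswzPoint : ℍ) : ℂ))‖ * ‖η (3 * ((bswzPoint : ℍ) : ℂ))‖ *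
        ‖η (6 * ((bswzPoint : ℍ) : ℂ))‖) ^ 4 =
      9 / 64 * (‖η (rootPoint 1 1 4)‖ ^ 4 * ‖η (rootPoint 2 1 2)‖ ^ 4) ^ 2 := by
  obtain ⟨h1, h3, h26⟩ := norm_eta_bswzPoint_pow_four
  calc _ = ‖η ((bswzPoint : ℍ) : ℂ)‖ ^ 4 * ‖η (3 * ((bswzPoint : ℍ) : ℂ))‖ ^ 4 *
        (‖η (2 * ((bswzPoint : ℍ) : ℂ))‖ ^ 4 * ‖η (6 * ((bswzPoint : ℍ) : ℂ))‖ ^ 4) := by ring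
    _ = _ := by rw [h1, h3, h26]; ring

/-- **The `5/3` singular value: `|η(τ₀)η(2τ₀)η(3τ₀)η(6τ₀)| = √(G/1200)/π`**,
`G = Γ(1/15)Γ(2/15)Γ(4/15)Γ(8/15)/(Γ(7/15)Γ(11/15)Γ(13/15)Γ(14/15))` (Chowla–Selberg at `−15` and
`−60`). [cite: BorweinEtAl2012, §5 Thm. 9] -/
theorem norm_eta_prod_bswzPoint :
    ‖η ((bswzPoint : ℍ) : ℂ)‖ * ‖η (2 * ((bswzPoint : ℍ) : ℂ))‖ * ‖η (3 * ((bswzPoint : ℍ) : ℂ))‖ *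
        ‖η (6 * ((bswzPoint : ℍ) : ℂ))‖ =
      Real.sqrt (Real.Gamma (1 / 15) * Real.Gamma (2 / 15) * Real.Gamma (4 / 15) *
        Real.Gamma (8 / 15) / (Real.Gamma (7 / 15) * Real.Gamma (11 / 15) * Real.Gamma (13 / 15) *
          Real.Gamma (14 / 15)) / 1200) / π := by
  set G := Real.Gamma (1 / 15) * Real.Gamma (2 / 15) * Real.Gamma (4 / 15) *
        Real.Gamma (8 / 15) / (Real.Gamma (7 / 15) * Real.Gamma (11 / 15) * Real.Gamma (13 / 15) *
          Real.Gamma (14 / 15)) with hG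
  have hGpos : 0 < G := by
    have hΓ : ∀ x : ℝ, 0 < x → 0 < Real.Gamma x := fun x hx => Real.Gamma_pos_of_pos hx
    have := hΓ (1/15) (by norm_num); have := hΓ (2/15) (by norm_num); have := hΓ (4/15) (by norm_num)
    have := hΓ (8/15) (by norm_num); have := hΓ (7/15) (by norm_num); have := hΓ (11/15) (by norm_num)
    have := hΓ (13/15) (by norm_num); have := hΓ (14/15) (by norm_num)
    positivity
  have h4 := norm_eta_prod_bswzPoint_pow_four
  have hCS := chowlaSelberg_fifteen_prod
  rw [← hG] at hCS
  -- `B₁B₂ = G/(450π²)`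
  have hB : ‖η (rootPoint 1 1 4)‖ ^ 4 * ‖η (rootPoint 2 1 2)‖ ^ 4 = G / (450 * π ^ 2) := by
    have hπ : (0 : ℝ) < π := Real.pi_pos
    field_simp
    linarith [hCS]
  rw [hB] at h4
  have hπ : (0 : ℝ) < π := Real.pi_pos
  have hR : 0 ≤ Real.sqrt (G / 1200) / π := by positivity
  refine (pow_left_inj₀ (by positivity) hR (by norm_num : (4 : ℕ) ≠ 0)).mp ?_
  have hs4 : (Real.sqrt (G / 1200) / π) ^ 4 = (G / 1200) ^ 2 / π ^ 4 := by
    rw [div_pow, show (4 : ℕ) = 2 * 2 from rfl, pow_mul, Real.sq_sqrt (by positivity)]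
  rw [h4, hs4]
  field_simp
  ring

/-- **The right-hand side of [BorweinEtAl2012, Thm. 9] as a modular value**: with `τ₀ = −1/2 + i√15/6`,
`|6(2τ₀ + 1)/π| · |η(τ₀)η(2τ₀)η(3τ₀)η(6τ₀)| = √(G/5)/(2π²)` (`|2τ₀ + 1| = √15/3`), i.e. the value of
`(6(2τ+1)/π) η(τ)η(2τ)η(3τ)η(6τ)` — BSWZ's (p4modular) parametrisation of `p₄` — at the point where
its argument `x(τ) = 8i(η(2τ)η(6τ)/(η(τ)η(3τ)))³` has modulus `1`. [cite: BorweinEtAl2012, §5 Thm. 9] -/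
theorem bswz_modular_value :
    ‖(6 * (2 * ((bswzPoint : ℍ) : ℂ) + 1) / π)‖ *
        (‖η ((bswzPoint : ℍ) : ℂ)‖ * ‖η (2 * ((bswzPoint : ℍ) : ℂ))‖ * ‖η (3 * ((bswzPoint : ℍ) : ℂ))‖ *
          ‖η (6 * ((bswzPoint : ℍ) : ℂ))‖) =
      1 / (2 * π ^ 2) * Real.sqrt (Real.Gamma (1 / 15) * Real.Gamma (2 / 15) * Real.Gamma (4 / 15) *
        Real.Gamma (8 / 15) / (5 * (Real.Gamma (7 / 15) * Real.Gamma (11 / 15) * Real.Gamma (13 / 15) *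
          Real.Gamma (14 / 15)))) := by
  rw [norm_eta_prod_bswzPoint]
  set G := Real.Gamma (1 / 15) * Real.Gamma (2 / 15) * Real.Gamma (4 / 15) *
        Real.Gamma (8 / 15) / (Real.Gamma (7 / 15) * Real.Gamma (11 / 15) * Real.Gamma (13 / 15) *
          Real.Gamma (14 / 15)) with hG
  have hGpos : 0 < G := by
    have hΓ : ∀ x : ℝ, 0 < x → 0 < Real.Gamma x := fun x hx => Real.Gamma_pos_of_pos hx
    have := hΓ (1/15) (by norm_num); have := hΓ (2/15) (by norm_num); have := hΓ (4/15) (by norm_num)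
    have := hΓ (8/15) (by norm_num); have := hΓ (7/15) (by norm_num); have := hΓ (11/15) (by norm_num)
    have := hΓ (13/15) (by norm_num); have := hΓ (14/15) (by norm_num)
    positivity
  have hG5 : Real.Gamma (1 / 15) * Real.Gamma (2 / 15) * Real.Gamma (4 / 15) *
        Real.Gamma (8 / 15) / (5 * (Real.Gamma (7 / 15) * Real.Gamma (11 / 15) * Real.Gamma (13 / 15) *
          Real.Gamma (14 / 15))) = G / 5 := by
    rw [hG]; field_simp
  rw [hG5]
  -- `|6(2τ₀+1)/π| = 2√15/π`
  have hnorm : ‖(6 * (2 * ((bswzPoint : ℍ) : ℂ) + 1) / π)‖ = 2 * Real.sqrt 15 / π := by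
    have hπ0 : (π : ℂ) ≠ 0 := Complex.ofReal_ne_zero.mpr Real.pi_ne_zero
    have hval : (6 * (2 * ((bswzPoint : ℍ) : ℂ) + 1) / π : ℂ) = ((2 * Real.sqrt 15 / π : ℝ) : ℂ) * I := by
      rw [coe_bswzPoint]
      push_cast
      field_simp
      ring
    rw [hval, norm_mul, Complex.norm_I, mul_one, Complex.norm_real,
      Real.norm_of_nonneg (by positivity)]
  rw [hnorm]
  have hπ : (0 : ℝ) < π := Real.pi_pos
  -- compare squares of the two positive sides
  have hL : 0 ≤ 2 * Real.sqrt 15 / π * (Real.sqrt (G / 1200) / π) := by positivity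
  have hR : 0 ≤ 1 / (2 * π ^ 2) * Real.sqrt (G / 5) := by positivity
  refine (pow_left_inj₀ hL hR (by norm_num : (2 : ℕ) ≠ 0)).mp ?_
  rw [mul_pow, mul_pow, div_pow, div_pow, mul_pow, Real.sq_sqrt (by norm_num),
    Real.sq_sqrt (by positivity), div_pow, Real.sq_sqrt (by positivity)]
  field_simp
  ring

/-- **`|Z(τ₀)|² = 4G/(75π²)`** for the weight-2 form `Z = η(τ)⁴η(3τ)⁴/(η(2τ)²η(6τ)²)`.
[cite: BorweinEtAl2012, §4 Remark 7] -/
theorem norm_dombModularForm_bswzPoint_sq :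
    ‖etaQuotient 6 dombExponents bswzPoint‖ ^ 2 =
      4 * (Real.Gamma (1 / 15) * Real.Gamma (2 / 15) * Real.Gamma (4 / 15) *
        Real.Gamma (8 / 15) / (Real.Gamma (7 / 15) * Real.Gamma (11 / 15) * Real.Gamma (13 / 15) *
          Real.Gamma (14 / 15))) / (75 * π ^ 2) := by
  obtain ⟨h1, h3, h26⟩ := norm_eta_bswzPoint_pow_four
  have hCS := chowlaSelberg_fifteen_prod
  set G := Real.Gamma (1 / 15) * Real.Gamma (2 / 15) * Real.Gamma (4 / 15) *
        Real.Gamma (8 / 15) / (Real.Gamma (7 / 15) * Real.Gamma (11 / 15) * Real.Gamma (13 / 15) *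
          Real.Gamma (14 / 15)) with hG
  have p1 := norm_eta_natMul_bswzPoint_pos 1 one_pos
  have p2 := norm_eta_natMul_bswzPoint_pos 2 (by norm_num)
  have p3 := norm_eta_natMul_bswzPoint_pos 3 (by norm_num)
  have p6 := norm_eta_natMul_bswzPoint_pos 6 (by norm_num)
  rw [Nat.cast_one, one_mul] at p1
  set n1 := ‖η ((bswzPoint : ℍ) : ℂ)‖ with hn1
  set n2 := ‖η (2 * ((bswzPoint : ℍ) : ℂ))‖ with hn2
  set n3 := ‖η (3 * ((bswzPoint : ℍ) : ℂ))‖ with hn3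
  set n6 := ‖η (6 * ((bswzPoint : ℍ) : ℂ))‖ with hn6
  set B1 := ‖η (rootPoint 1 1 4)‖ ^ 4 with hB1
  set B2 := ‖η (rootPoint 2 1 2)‖ ^ 4 with hB2
  have hB1p : 0 < B1 := by
    have := norm_pos_iff.mpr (ModularForm.eta_ne_zero (rootPoint_mem_upperHalfPlaneSet isPosDefForm_Q₁))
    positivity
  have hB2p : 0 < B2 := by
    have := norm_pos_iff.mpr (ModularForm.eta_ne_zero (rootPoint_mem_upperHalfPlaneSet isPosDefForm_Q₂))
    positivity
  rw [etaQuotient_apply, show (6 : ℕ).divisors = {1, 2, 3, 6} by decide]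
  rw [Finset.prod_insert (by decide), Finset.prod_insert (by decide), Finset.prod_insert (by decide),
    Finset.prod_singleton]
  simp only [dombExponents, Nat.cast_one, one_mul, norm_mul, norm_zpow, Nat.cast_ofNat]
  norm_num
  rw [← hn1, ← hn2, ← hn3, ← hn6]
  -- `|Z|² = n1⁸ n3⁸/(n2 n6)⁴ = ((3/2)B₂ B₁)²/((3/32) B₁B₂) = 24 B₁B₂ = 24 G/(450π²)`
  have hπ : (0 : ℝ) < π := Real.pi_pos
  have h26' : (n2 * n6) ^ 4 = 3 / 32 * (B1 * B2) := by rw [mul_pow]; exact h26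
  have hsq : (n1 ^ 4 * ((n2 ^ 2)⁻¹ * (n3 ^ 4 * (n6 ^ 2)⁻¹))) ^ 2 =
      (n1 ^ 4) ^ 2 * (n3 ^ 4) ^ 2 / (n2 * n6) ^ 4 := by
    field_simp
  have e : (n1 ^ 4 * ((n2 ^ 2)⁻¹ * (n3 ^ 4 * (n6 ^ 2)⁻¹))) ^ 2 = 4 * G / (75 * π ^ 2) := by
    rw [hsq, h1, h3, h26', hCS]
    field_simp
    ring
  exact e

end Literature.NumberTheory.ModularForms

end
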